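import Summits.BirchSwinnertonDyer.Rank1Residual.Additive.PowerMapSubstitution
import Summits.BirchSwinnertonDyer.Rank1Residual.X1.GeneratorCountLayer
import Mathlib.RingTheory.Norm.Transitivity
import HarnessLib

/-!
# The layer-`n` Iwasawa algebra `Λ_n = ℤ_p⟦ω_n⟧ ⊂ Λ`: `Λ` is free of rank `pⁿ` over it; the norm `N_n`

B2B cell `bsd-rank1-residual`, unit `eisenstein-p1` GEN 18, FILE 13 (X1R0-GAPMAP §27,
`V76-LOCAL-TERM-PLAN.md` §3.1 = (M3-n), V87). HONEST FRAMING: research route; pure commutative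
algebra of `Λ = ℤ_p⟦T⟧`; nothing about any curve; nothing booked; no label moved. This file
introduces ONE type synonym with its structure and the coordinate / norm maps (reviewed
definitions); nothing is posited.

LEMMA M at LAYER `n` reads the generator count `#(X/(p, ω_n)X)` of a torsion Iwasawa module `X`,
`ω_n = (1+T)^{pⁿ} − 1`, as a count of generators over the SUBRING `Λ_n = ℤ_p⟦ω_n⟧ ⊂ Λ` (the
Iwasawa algebra of `Γ^{pⁿ}`) and concludes `N_{Λ/Λ_n}(char_Λ X) ∈ 𝔪_{Λ_n}^B`. Ring-theoretic input:
* §1 `layerHom p n : Λ →+* Λ`, `T ↦ ω_n` (Mathlib `PowerSeries.substAlgHom`; injective) — the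
  isomorphism `ℤ_p⟦S⟧ ≅ Λ_n`;
* §2 `Layer p n`: the type synonym of `Λ` made a `Λ`-ALGEBRA through `layerHom p n`, so that
  Mathlib's `Algebra.norm`, `LinearMap.det_restrictScalars`, … apply to `Λ/Λ_n` without clashing
  with `Algebra.id`; `Layer.of : Λ ≃+* Layer p n` is the identity;
* §3 Weierstrass division by the distinguished polynomial `ω_n` (Mathlib `weierstrassDiv/Mod`,
  `IsWeierstrassDivision.elim`): `(c_i)_{i<pⁿ} ↦ ∑ c_i(ω_n) T^i` is INJECTIVE (uniqueness of
  division, induction on the coefficient index) and SURJECTIVE (iterated division; `coord`);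
* §4 **`Layer.basis`: `1, T, …, T^{pⁿ−1}` is a `Λ_n`-basis of `Λ`** (free, finite, rank `pⁿ`);
  §5 the NORM `layerNorm p n = N_n : Λ →* Λ` (`Algebra.norm`): `N_n(a(ω_n)) = a^{pⁿ}`, `N_n(f) ≠ 0`,
  `N_n(f) = det Q` from the multiplication table `f·T^j = ∑_i Q_{ji}(ω_n) T^i`.

## Sources
* L. Washington, *Introduction to Cyclotomic Fields*, GTM 83, §7.1 (Prop. 7.2), §13.2
  (`ω_n`, Lemma 13.15 ff.) [Washington1997]; S. Lang, *Cyclotomic Fields I and II*, Ch. 5 §1–§2.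
-/
noncomputable section

namespace Summit.BirchSwinnertonDyer.Rank1Residual.X1.LayerAlgebra

open PowerSeries IsLocalRing Literature.NumberTheory.EllipticCurves
  Summit.BirchSwinnertonDyer.Rank1Residual.Additive

variable (p : ℕ) [hp : Fact p.Prime] (n : ℕ)

/-! ## §1. The substitution `T ↦ ω_n = (1+T)^{pⁿ} − 1` -/

/-- **`layerHom p n : Λ →+* Λ`, `g(T) ↦ g(ω_n)`, `ω_n = (1+T)^{pⁿ} − 1`** — the continuous
`ℤ_p`-algebra endomorphism of `Λ = ℤ_p⟦T⟧` induced by `γ ↦ γ^{pⁿ}`; its image is the Iwasawa algebra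
`Λ_n = ℤ_p⟦ω_n⟧` of `Γ^{pⁿ}` (Mathlib `PowerSeries.substAlgHom`). [cite: Washington1997, §13.2] -/
def layerHom : IwasawaAlgebra p →+* IwasawaAlgebra p :=
  (substAlgHom (hasSubst_one_add_X_pow_sub_one (R := ℤ_[p]) (p ^ n))).toRingHom

/-- `layerHom p n g = g.subst ω_n`. [folklore] -/
theorem layerHom_apply (g : IwasawaAlgebra p) :
    layerHom p n g = g.subst ((1 + X : IwasawaAlgebra p) ^ p ^ n - 1) := by
  rw [layerHom, AlgHom.toRingHom_eq_coe, RingHom.coe_coe, coe_substAlgHom]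

/-- `layerHom p n T = ω_n`. [folklore] -/
@[simp] theorem layerHom_X : layerHom p n X = (1 + X : IwasawaAlgebra p) ^ p ^ n - 1 := by
  rw [layerHom_apply, subst_X (hasSubst_one_add_X_pow_sub_one _)]

/-- `layerHom p n` fixes constants. [folklore] -/
@[simp] theorem layerHom_C (a : ℤ_[p]) : layerHom p n (C a) = C a := by
  rw [layerHom_apply, subst_C]; rfl

/-- `layerHom p n` is injective (`pⁿ ≠ 0` in characteristic zero). [folklore] -/
theorem layerHom_injective : Function.Injective (layerHom p n) := by
  rw [injective_iff_map_eq_zero]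
  intro g hg
  rw [layerHom_apply] at hg
  exact eq_zero_of_subst_one_add_X_pow_sub_one_eq_zero (p ^ n) (pow_ne_zero n hp.out.ne_zero) hg

/-! ## §2. The type synonym `Layer p n`: `Λ` as an algebra over `Λ_n ≅ Λ` -/

/-- **`Layer p n`**: the Iwasawa algebra `Λ = ℤ_p⟦T⟧` regarded as an algebra over (a copy of)
itself through `layerHom p n : S ↦ ω_n` — i.e. the finite free extension `Λ ⊃ Λ_n = ℤ_p⟦ω_n⟧`.
A type synonym, so that this algebra structure does not clash with `Algebra.id`.
[cite: Washington1997, §13.2] -/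
def Layer (p : ℕ) [Fact p.Prime] (_n : ℕ) : Type := IwasawaAlgebra p

namespace Layer

/-- The ring structure of `Λ`. [folklore] -/
instance instCommRing : CommRing (Layer p n) := inferInstanceAs (CommRing (IwasawaAlgebra p))

/-- `Λ` is a domain. [folklore] -/
instance instIsDomain : IsDomain (Layer p n) := inferInstanceAs (IsDomain (IwasawaAlgebra p))

/-- The identity `Λ ≃+* Layer p n` (the element `f ∈ Λ` regarded in the extension). [folklore] -/
def of : IwasawaAlgebra p ≃+* Layer p n := RingEquiv.refl _

/-- The `Λ`-algebra structure of `Layer p n`: `a • f = a(ω_n) · f`. [cite: Washington1997, §13.2] -/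
instance instAlgebra : Algebra (IwasawaAlgebra p) (Layer p n) :=
  ((of p n).toRingHom.comp (layerHom p n)).toAlgebra

/-- `algebraMap Λ (Layer p n) a = of (a(ω_n))`. [folklore] -/
theorem algebraMap_apply (a : IwasawaAlgebra p) :
    algebraMap (IwasawaAlgebra p) (Layer p n) a = of p n (layerHom p n a) := rfl

/-- `a • of g = of (a(ω_n) · g)`. [folklore] -/
theorem smul_of (a g : IwasawaAlgebra p) : a • of p n g = of p n (layerHom p n a * g) := by
  rw [Algebra.smul_def, map_mul]; rfl

end Layer

/-! ## §3. Weierstrass division by `ω_n`: the coordinate map is bijective -/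

section Division

/-- `ω_n ≡ T^{pⁿ} (mod p)` (`p ∣ binom(pⁿ, k)` for `0 < k < pⁿ`). [cite: Washington1997, §7.1] -/
theorem map_residue_omega :
    PowerSeries.map (residue ℤ_[p]) ((1 + X : IwasawaAlgebra p) ^ p ^ n - 1) = X ^ p ^ n := by
  obtain ⟨c, hc⟩ := GeneratorCountLayer.C_p_dvd_omega_sub_X_pow (p := p) n
  rw [sub_eq_iff_eq_add'] at hc
  rw [hc, map_add, map_pow, map_X, map_mul, map_C, (residue_eq_zero_iff _).2
    (by rw [PadicInt.maximalIdeal_eq_span_p]; exact Ideal.mem_span_singleton_self _), map_zero,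
    zero_mul, add_zero]

/-- `ω_n mod p ≠ 0`, so `ω_n` is a Weierstrass divisor. [folklore] -/
theorem map_residue_omega_ne_zero :
    PowerSeries.map (residue ℤ_[p]) ((1 + X : IwasawaAlgebra p) ^ p ^ n - 1) ≠ 0 := by
  rw [map_residue_omega]
  exact pow_ne_zero _ X_ne_zero

/-- The order of `ω_n mod p` is `pⁿ`: Weierstrass remainders have degree `< pⁿ`. [folklore] -/
theorem order_map_residue_omega_toNat :
    (PowerSeries.map (residue ℤ_[p]) ((1 + X : IwasawaAlgebra p) ^ p ^ n - 1)).order.toNat =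
      p ^ n := by
  rw [map_residue_omega, order_X_pow]
  rfl

variable {p n}

/-- The coordinate map `χ₀ : (c_i)_{i<pⁿ} ↦ ∑_i c_i(ω_n) · T^i` (written out; it is the `Λ`-linear
combination map of the family `T^i` in `Layer p n`). [folklore] -/
theorem sum_layerHom_mul_X_pow_eq_omega_mul_add (c : Fin (p ^ n) → IwasawaAlgebra p) :
    ∑ i, layerHom p n (c i) * X ^ (i : ℕ) =
      ((1 + X : IwasawaAlgebra p) ^ p ^ n - 1) *
          ∑ i, layerHom p n (PowerSeries.mk fun j => coeff (j + 1) (c i)) * X ^ (i : ℕ) +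
        ((∑ i : Fin (p ^ n), Polynomial.C (constantCoeff (c i)) * Polynomial.X ^ (i : ℕ) :
          Polynomial ℤ_[p]) : IwasawaAlgebra p) := by
  have hsum : ((∑ i : Fin (p ^ n), Polynomial.C (constantCoeff (c i)) * Polynomial.X ^ (i : ℕ) :
      Polynomial ℤ_[p]) : IwasawaAlgebra p) = ∑ i : Fin (p ^ n),
        ((Polynomial.C (constantCoeff (c i)) * Polynomial.X ^ (i : ℕ) : Polynomial ℤ_[p]) :
          IwasawaAlgebra p) := by
    have h := map_sum (Polynomial.coeToPowerSeries.ringHom (R := ℤ_[p]))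
      (fun i : Fin (p ^ n) => Polynomial.C (constantCoeff (c i)) * Polynomial.X ^ (i : ℕ))
      Finset.univ
    simpa only [Polynomial.coeToPowerSeries.ringHom_apply] using h
  rw [Finset.mul_sum, hsum, ← Finset.sum_add_distrib]
  refine Finset.sum_congr rfl fun i _ => ?_
  rw [Polynomial.coe_mul, Polynomial.coe_pow, Polynomial.coe_C, Polynomial.coe_X]
  conv_lhs => rw [eq_X_mul_shift_add_const (c i)]
  rw [map_add, map_mul, layerHom_X, layerHom_C]
  ring

/-- **Division step:** `χ₀(c) = ω_n · χ₀(shift c) + ∑_i c_i(0) T^i` is THE Weierstrass division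
of `χ₀(c)` by `ω_n` (remainder of degree `< pⁿ`). [cite: Washington1997, Prop. 7.2] -/
theorem isWeierstrassDivision_sum (c : Fin (p ^ n) → IwasawaAlgebra p) :
    IsWeierstrassDivision (∑ i, layerHom p n (c i) * X ^ (i : ℕ))
      ((1 + X : IwasawaAlgebra p) ^ p ^ n - 1)
      (∑ i, layerHom p n (PowerSeries.mk fun j => coeff (j + 1) (c i)) * X ^ (i : ℕ))
      (∑ i : Fin (p ^ n), Polynomial.C (constantCoeff (c i)) * Polynomial.X ^ (i : ℕ)) := by
  refine ⟨?_, sum_layerHom_mul_X_pow_eq_omega_mul_add c⟩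
  change _ < ((PowerSeries.map (residue ℤ_[p])
    ((1 + X : IwasawaAlgebra p) ^ p ^ n - 1)).order.toNat : WithBot ℕ)
  rw [order_map_residue_omega_toNat p n]
  exact Polynomial.degree_sum_fin_lt _

/-- A polynomial `∑_{i<d} a_i X^i` vanishes only if all `a_i` do. [folklore] -/
theorem eq_zero_of_sum_C_mul_X_pow_eq_zero {d : ℕ} (a : Fin d → ℤ_[p])
    (h : ∑ i : Fin d, Polynomial.C (a i) * Polynomial.X ^ (i : ℕ) = 0) (i : Fin d) : a i = 0 := by
  have hc := congr_arg (fun q : Polynomial ℤ_[p] => q.coeff i) h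
  simp only [Polynomial.finsetSum_coeff, Polynomial.coeff_C_mul_X_pow, Fin.val_inj,
    Finset.sum_ite_eq, Finset.mem_univ, if_true, Polynomial.coeff_zero] at hc
  exact hc

/-- **Injectivity of the coordinate map** `χ₀`: if `∑_i c_i(ω_n) T^i = 0` then `c = 0`
(uniqueness of Weierstrass division: `c_i(0) = 0` and `χ₀(shift c) = 0`; induction on the
coefficient index). [cite: Washington1997, Prop. 7.2] -/
theorem eq_zero_of_sum_layerHom_mul_X_pow_eq_zero :
    ∀ (k : ℕ) (c : Fin (p ^ n) → IwasawaAlgebra p),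
      ∑ i, layerHom p n (c i) * X ^ (i : ℕ) = 0 → ∀ i, coeff k (c i) = 0 := by
  intro k
  induction k with
  | zero =>
    intro c hc i
    rw [coeff_zero_eq_constantCoeff_apply]
    exact eq_zero_of_sum_C_mul_X_pow_eq_zero _ ((isWeierstrassDivision_sum c).elim
      (map_residue_omega_ne_zero p n) (by rw [hc]; exact isWeierstrassDivisionAt_zero _ _)).2 i
  | succ k ih =>
    intro c hc i
    have h := ih _ ((isWeierstrassDivision_sum c).elim (map_residue_omega_ne_zero p n)
      (by rw [hc]; exact isWeierstrassDivisionAt_zero _ _)).1 i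
    rwa [coeff_mk] at h

variable (p n)

/-- The layer-`n` COORDINATES of `g ∈ Λ`: `coord g i = ∑_k [T^i](d_k %ʷ ω_n) S^k` with
`d_k = g /ʷ ω_n /ʷ … /ʷ ω_n` (`k` times), so that `g = ∑_{i<pⁿ} (coord g i)(ω_n) T^i`
(`sum_layerHom_coord_mul_X_pow`). [cite: Washington1997, §13.2] -/
def coord (g : IwasawaAlgebra p) (i : Fin (p ^ n)) : IwasawaAlgebra p :=
  PowerSeries.mk fun k =>
    ((fun d => d /ʷ ((1 + X : IwasawaAlgebra p) ^ p ^ n - 1))^[k] g %ʷ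
      ((1 + X : IwasawaAlgebra p) ^ p ^ n - 1)).coeff i

variable {p n}

/-- `shift (coord g i) = coord (g /ʷ ω_n) i`. [folklore] -/
theorem shift_coord (g : IwasawaAlgebra p) (i : Fin (p ^ n)) :
    (PowerSeries.mk fun j => coeff (j + 1) (coord p n g i)) =
      coord p n (g /ʷ ((1 + X : IwasawaAlgebra p) ^ p ^ n - 1)) i := by
  ext j
  rw [coeff_mk, coord, coord, coeff_mk, coeff_mk, Function.iterate_succ_apply]

/-- The remainder of `g` by `ω_n` is `∑_{i<pⁿ} (coord g i)(0) X^i`. [folklore] -/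
theorem sum_C_constantCoeff_coord (g : IwasawaAlgebra p) :
    ∑ i : Fin (p ^ n), Polynomial.C (constantCoeff (coord p n g i)) * Polynomial.X ^ (i : ℕ) =
      g %ʷ ((1 + X : IwasawaAlgebra p) ^ p ^ n - 1) := by
  set r := g %ʷ ((1 + X : IwasawaAlgebra p) ^ p ^ n - 1) with hr
  have hdeg : r.degree < (p ^ n : ℕ) := by
    have := degree_weierstrassMod_lt g ((1 + X : IwasawaAlgebra p) ^ p ^ n - 1)
    rwa [order_map_residue_omega_toNat] at this
  have hcoeff : ∀ i : Fin (p ^ n), constantCoeff (coord p n g i) = r.coeff i := fun i => by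
    rw [← coeff_zero_eq_constantCoeff_apply, coord, coeff_mk, Function.iterate_zero_apply]
  rw [Polynomial.degree_lt_iff_coeff_zero] at hdeg
  ext k
  rw [Polynomial.finsetSum_coeff]
  by_cases hk : k < p ^ n
  · rw [Finset.sum_eq_single (⟨k, hk⟩ : Fin (p ^ n))]
    · rw [Polynomial.coeff_C_mul_X_pow, if_pos rfl, hcoeff]
    · intro j _ hj
      rw [Polynomial.coeff_C_mul_X_pow, if_neg fun h : k = (j : ℕ) => hj (Fin.ext h.symm)]
    · intro h
      exact absurd (Finset.mem_univ _) h
  · rw [hdeg k (not_lt.1 hk)]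
    refine Finset.sum_eq_zero fun j _ => ?_
    rw [Polynomial.coeff_C_mul_X_pow, if_neg fun h : k = (j : ℕ) => hk (h ▸ j.2)]

/-- The error `g − χ₀(coord g)` satisfies `E(g) = ω_n · E(g /ʷ ω_n)`. [folklore] -/
theorem sub_sum_eq_omega_mul (g : IwasawaAlgebra p) :
    g - ∑ i, layerHom p n (coord p n g i) * X ^ (i : ℕ) =
      ((1 + X : IwasawaAlgebra p) ^ p ^ n - 1) *
        (g /ʷ ((1 + X : IwasawaAlgebra p) ^ p ^ n - 1) -
          ∑ i, layerHom p n (coord p n (g /ʷ ((1 + X : IwasawaAlgebra p) ^ p ^ n - 1)) i) *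
            X ^ (i : ℕ)) := by
  have h1 := eq_mul_weierstrassDiv_add_weierstrassMod g (map_residue_omega_ne_zero p n)
  have h2 := sum_layerHom_mul_X_pow_eq_omega_mul_add (coord p n g)
  simp_rw [shift_coord] at h2
  rw [sum_C_constantCoeff_coord] at h2
  linear_combination h1 - h2

/-- `ω_n^K ∣ g − χ₀(coord g)` for every `K`. [folklore] -/
theorem omega_pow_dvd_sub_sum (K : ℕ) :
    ∀ g : IwasawaAlgebra p, ((1 + X : IwasawaAlgebra p) ^ p ^ n - 1) ^ K ∣
      g - ∑ i, layerHom p n (coord p n g i) * X ^ (i : ℕ) := by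
  induction K with
  | zero => intro g; rw [pow_zero]; exact one_dvd _
  | succ K ih =>
    intro g
    rw [sub_sum_eq_omega_mul, pow_succ']
    exact mul_dvd_mul_left _ (ih _)

/-- **Surjectivity of the coordinate map:** `g = ∑_{i<pⁿ} (coord g i)(ω_n) · T^i` — the error is
divisible by `ω_n^K`, hence by `T^K`, for every `K`. [cite: Washington1997, §13.2] -/
theorem sum_layerHom_coord_mul_X_pow (g : IwasawaAlgebra p) :
    ∑ i, layerHom p n (coord p n g i) * X ^ (i : ℕ) = g := by
  rw [← sub_eq_zero, ← neg_sub, neg_eq_zero]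
  ext m
  rw [map_zero]
  have h : (X : IwasawaAlgebra p) ^ (m + 1) ∣ g - ∑ i, layerHom p n (coord p n g i) * X ^ (i : ℕ) := by
    refine dvd_trans ?_ (omega_pow_dvd_sub_sum (m + 1) g)
    rw [one_add_X_pow_sub_one_eq_X_mul, mul_pow]
    exact dvd_mul_right _ _
  exact (X_pow_dvd_iff.1 h) m (Nat.lt_succ_self m)

end Division

/-! ## §4. The basis `1, T, …, T^{pⁿ−1}` of `Layer p n` over `Λ`; the norm `N_n` -/

namespace Layer

/-- `∑_i c_i • of(T^i) = of(∑_i c_i(ω_n) T^i)`. [folklore] -/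
theorem linearCombination_apply (c : Fin (p ^ n) → IwasawaAlgebra p) :
    Fintype.linearCombination (IwasawaAlgebra p) (fun i : Fin (p ^ n) => of p n (X ^ (i : ℕ))) c =
      of p n (∑ i, layerHom p n (c i) * X ^ (i : ℕ)) := by
  rw [Fintype.linearCombination_apply, map_sum]
  exact Finset.sum_congr rfl fun i _ => smul_of p n _ _

/-- The coordinate map `(c_i) ↦ ∑ c_i • T^i` is bijective onto `Layer p n`. [cite: Washington1997, §13.2] -/
theorem linearCombination_bijective :
    Function.Bijective (Fintype.linearCombination (IwasawaAlgebra p)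
      (fun i : Fin (p ^ n) => of p n (X ^ (i : ℕ)))) := by
  constructor
  · rw [injective_iff_map_eq_zero]
    intro c hc
    rw [linearCombination_apply, map_eq_zero_iff _ (of p n).injective] at hc
    ext i k
    rw [eq_zero_of_sum_layerHom_mul_X_pow_eq_zero k c hc i]
    rfl
  · intro f
    refine ⟨coord p n ((of p n).symm f), ?_⟩
    rw [linearCombination_apply, sum_layerHom_coord_mul_X_pow, RingEquiv.apply_symm_apply]

/-- **The `Λ_n`-basis `1, T, …, T^{pⁿ−1}` of `Λ`** (as the `Λ`-basis `of(T^i)` of `Layer p n`).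
[cite: Washington1997, §13.2] -/
def basis : Module.Basis (Fin (p ^ n)) (IwasawaAlgebra p) (Layer p n) :=
  Module.Basis.ofEquivFun (LinearEquiv.ofBijective _ (linearCombination_bijective p n)).symm

/-- `basis i = of(T^i)`. [folklore] -/
@[simp] theorem basis_apply (i : Fin (p ^ n)) : basis p n i = of p n (X ^ (i : ℕ)) := by
  classical
  rw [basis, Module.Basis.coe_ofEquivFun]
  simp only [LinearEquiv.symm_symm]
  show (LinearEquiv.ofBijective _ (linearCombination_bijective p n)) (Pi.single i 1) = _
  rw [LinearEquiv.ofBijective_apply, Fintype.linearCombination_apply,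
    Finset.sum_eq_single i (fun j _ hj => by rw [Pi.single_eq_of_ne hj, zero_smul])
      (fun h => absurd (Finset.mem_univ i) h), Pi.single_eq_same, one_smul]

/-- The coordinates of `of g` in the basis are `coord g`. [folklore] -/
theorem basis_repr_of (g : IwasawaAlgebra p) (i : Fin (p ^ n)) :
    (basis p n).repr (of p n g) i = coord p n g i := by
  have h : of p n g = ∑ j, coord p n g j • basis p n j := by
    simp_rw [basis_apply]
    rw [← Fintype.linearCombination_apply, linearCombination_apply, sum_layerHom_coord_mul_X_pow]
  rw [h, (basis p n).repr_sum_self]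

/-- `Λ` is FREE over `Λ_n`. [cite: Washington1997, §13.2] -/
instance instFree : Module.Free (IwasawaAlgebra p) (Layer p n) := Module.Free.of_basis (basis p n)

/-- `Λ` is finite over `Λ_n`. [cite: Washington1997, §13.2] -/
instance instFinite : Module.Finite (IwasawaAlgebra p) (Layer p n) :=
  Module.Finite.of_basis (basis p n)

/-- `rank_{Λ_n} Λ = pⁿ`. [cite: Washington1997, §13.2] -/
theorem finrank_eq : Module.finrank (IwasawaAlgebra p) (Layer p n) = p ^ n := by
  rw [Module.finrank_eq_card_basis (basis p n), Fintype.card_fin]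

/-- **Every `g ∈ Λ` is `∑_{i<pⁿ} a_i(ω_n) T^i` with unique `a_i ∈ Λ`.** [cite: Washington1997, §13.2] -/
theorem existsUnique_eq_sum_layerHom_mul_X_pow (g : IwasawaAlgebra p) :
    ∃! a : Fin (p ^ n) → IwasawaAlgebra p, g = ∑ i, layerHom p n (a i) * X ^ (i : ℕ) := by
  refine ⟨coord p n g, (sum_layerHom_coord_mul_X_pow g).symm, fun a ha => ?_⟩
  apply (linearCombination_bijective p n).1
  rw [linearCombination_apply, linearCombination_apply, ← ha, sum_layerHom_coord_mul_X_pow]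

end Layer

/-! ## §5. The layer norm `N_n : Λ →* Λ` -/

/-- **The layer-`n` norm `N_n = N_{Λ/Λ_n} : Λ →* Λ`**, `N_n(f) = det_{Λ_n}(g ↦ f·g)` written in
the variable `S = T` of `Λ_n = ℤ_p⟦S⟧`, `S ↦ ω_n` (Mathlib `Algebra.norm` of the finite free
extension `Layer p n`); classically `N_n(f)(ω_n) = ∏_{ζ^{pⁿ}=1} f(ζ(1+T) − 1)`. Multiplicative
(a `MonoidHom`). [cite: Washington1997, §13.2] -/
def layerNorm : IwasawaAlgebra p →* IwasawaAlgebra p :=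
  (Algebra.norm (IwasawaAlgebra p) (S := Layer p n)).comp (Layer.of p n).toRingHom.toMonoidHom

/-- `N_n(f) = Algebra.norm Λ (of f)`. [folklore] -/
theorem layerNorm_apply (f : IwasawaAlgebra p) :
    layerNorm p n f = Algebra.norm (IwasawaAlgebra p) (Layer.of p n f) := rfl

/-- `N_n(a(ω_n)) = a^{pⁿ}` (the norm on `Λ_n` itself). [folklore] -/
theorem layerNorm_layerHom (a : IwasawaAlgebra p) : layerNorm p n (layerHom p n a) = a ^ p ^ n := by
  rw [layerNorm_apply, ← Layer.algebraMap_apply, Algebra.norm_algebraMap, Layer.finrank_eq]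

/-- `N_n(a) = a^{pⁿ}` for a constant `a ∈ ℤ_p`. [folklore] -/
theorem layerNorm_C (a : ℤ_[p]) : layerNorm p n (C a) = C (a ^ p ^ n) := by
  rw [← layerHom_C p n a, layerNorm_layerHom, map_pow]

/-- `N_n(f) ≠ 0` for `f ≠ 0`. [folklore] -/
theorem layerNorm_ne_zero {f : IwasawaAlgebra p} (hf : f ≠ 0) : layerNorm p n f ≠ 0 := by
  rw [layerNorm_apply]
  exact Algebra.norm_ne_zero_iff.2 ((map_ne_zero_iff _ (Layer.of p n).injective).2 hf)

/-- Associated elements have associated norms. [folklore] -/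
theorem associated_layerNorm {f g : IwasawaAlgebra p} (h : Associated f g) :
    Associated (layerNorm p n f) (layerNorm p n g) :=
  h.map _

/-- **Computing `N_n`:** if `f · T^j = ∑_i Q_{j i}(ω_n) · T^i` for all `j < pⁿ` (the matrix of
multiplication by `f` in the basis `T^i`, found by division by `ω_n`), then `N_n(f) = det Q`.
[folklore] -/
theorem layerNorm_eq_det {f : IwasawaAlgebra p}
    (Q : Matrix (Fin (p ^ n)) (Fin (p ^ n)) (IwasawaAlgebra p))
    (hQ : ∀ j : Fin (p ^ n), f * X ^ (j : ℕ) = ∑ i, layerHom p n (Q j i) * X ^ (i : ℕ)) :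
    layerNorm p n f = Q.det := by
  rw [layerNorm_apply, Algebra.norm_eq_matrix_det (Layer.basis p n), ← Matrix.det_transpose]
  congr 1
  ext i j : 1
  rw [Matrix.transpose_apply, Algebra.leftMulMatrix_eq_repr_mul, Layer.basis_apply, ← map_mul,
    Layer.basis_repr_of]
  have h := (Layer.existsUnique_eq_sum_layerHom_mul_X_pow p n (f * X ^ (i : ℕ))).unique
    (sum_layerHom_coord_mul_X_pow (f * X ^ (i : ℕ))).symm (hQ i)
  exact congr_fun h j

end Summit.BirchSwinnertonDyer.Rank1Residual.X1.LayerAlgebra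

end
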